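import Mathlib
import HarnessLib
import Summits.HubbardSuperconductivity.HubbardSuperconductivity.Theses.LiebTwin
import Summits.HubbardSuperconductivity.HubbardSuperconductivity.Theorems.LiebTwinNoOnsiteODLROHalfFillingGaussianDomination
import Summits.HubbardSuperconductivity.HubbardSuperconductivity.Theorems.EnslavedA1gLowerSandwich
import Literature.MathematicalPhysics.QuantumLattice.PairingChannelIdentities

/-!
# Falk–Bruch at zero temperature: charge fluctuations of the half-filled Hubbard ground state

Helper file (`--supports stmt-HubbardSuperconductivity-0933`, crux `NoOnsiteODLRO`; route-prover LiebTwin-0,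
session 5), sequel of `LiebTwinNoOnsiteODLROHalfFillingGaussianDomination` (Kubo–Kishi's Gaussian
domination at `T = 0`, `gaussianDomination_halfFilled`) and second input of the `δ = 0` endpoint
(`LiebTwinNoOnsiteODLROHalfFillingEndpoint`).

**`chargeFluctuation_falkBruch`.** On a bipartite graph, `U > 0`, a half-filled sector `(a, b)`
(`a + b = |Λ|`) with lower bound `E` of `H = hamiltonian G t U`, a ground state `ψ₀` of that sector AT `E`
(`Hψ₀ = Eψ₀`) and a real field `k`, the fluctuation vector `φ = Σ_x k_x (n_x - 1) ψ₀` obeys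

  `‖φ‖⁴ ≤ ⟨φ, (H - E) φ⟩ · (Σ_x k_x² / (2U)) · ‖ψ₀‖²`.

This is the zero-temperature Falk–Bruch / Dyson–Lieb–Simon inequality `½⟨{A,A}⟩ ≤ √(b·c)` with the
susceptibility `b` bounded by Gaussian domination and `c = ⟨φ,(H-E)φ⟩` the double commutator, obtained
here without resolvents: Gaussian domination is applied to the trial states `ψ₀ - rφ` with the fields
`θk` (`tian_re_form_sub_smul` expands the three quadratic forms; the cross terms are `⟨ψ₀, M_kφ⟩ = ‖φ‖²`,
`⟨ψ₀,(H-E)φ⟩ = 0`), the two signs `(r, θ) = (∓s, ±τ)` are added, `s = στ` and `τ → 0`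
(`le_of_forall_pos_le_add_mul_sq`), and `σ` is optimised (`sq_le_mul_of_forall_pos`). The statement is
instance-free (`φ` is given in the shifted form `Σ_x k_x n_x ψ₀ - (Σ_x k_x) ψ₀`) so that it specialises
verbatim to the torus: registered stub **`stub_halfFillingChargeFluctuation`**.

References: F. J. Dyson, E. H. Lieb, B. Simon, J. Stat. Phys. 18 (1978) 335, Thm 3.2 and its `β → ∞`
corollary [DLS1978]; K. Kubo, T. Kishi, Phys. Rev. B 41 (1990) 4866, Remark after Thm 2 [KuboKishi1990];
H. Falk, L. W. Bruch, Phys. Rev. 180 (1969) 442. Everything is proved; no definition and no named fact is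
introduced.
-/

-- the mandated namespace `Summit.<Summit>.<Problem>.Theorems` repeats `HubbardSuperconductivity`
set_option linter.dupNamespace false

noncomputable section

namespace Summit.HubbardSuperconductivity.HubbardSuperconductivity.Theorems.NoOnsiteODLRO.HalfFilling

open Matrix Finset
open Literature.Probability.LatticeModels Literature.MathematicalPhysics.QuantumLattice
open Literature.MathematicalPhysics.QuantumLattice.LiebTwo
open scoped ComplexOrder

/-! ## Falk–Bruch: fluctuation bound from Gaussian domination -/

section RealAnalysis

/-- If `a ≤ b + d τ²` for all `τ > 0` (`d ≥ 0`) then `a ≤ b`. [folklore] -/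
theorem le_of_forall_pos_le_add_mul_sq {a b d : ℝ} (hd : 0 ≤ d) (h : ∀ τ : ℝ, 0 < τ → a ≤ b + d * τ ^ 2) :
    a ≤ b := by
  refine le_of_forall_pos_lt_add fun ε hε => ?_
  set τ : ℝ := min 1 (ε / (2 * (d + 1))) with hτ
  have hτpos : 0 < τ := by
    rw [hτ, lt_min_iff]
    exact ⟨one_pos, by positivity⟩
  have hτ1 : τ ≤ 1 := min_le_left _ _
  have hτ2 : τ ≤ ε / (2 * (d + 1)) := min_le_right _ _
  have hττ : τ ^ 2 ≤ τ := by nlinarith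
  have h1 : d * τ ^ 2 ≤ (d + 1) * τ := by nlinarith [mul_le_mul_of_nonneg_left hττ hd]
  have h2 : (d + 1) * τ ≤ ε / 2 := by
    calc (d + 1) * τ ≤ (d + 1) * (ε / (2 * (d + 1))) := by gcongr
      _ = ε / 2 := by field_simp
  linarith [h τ hτpos]

/-- If `2σg ≤ σ²c + B` for all `σ > 0` (`g, c, B ≥ 0`) then `g² ≤ cB` (optimise `σ`). [folklore] -/
theorem sq_le_mul_of_forall_pos {g c B : ℝ} (hg : 0 ≤ g) (hc : 0 ≤ c) (hB : 0 ≤ B)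
    (h : ∀ σ : ℝ, 0 < σ → 2 * σ * g ≤ σ ^ 2 * c + B) : g ^ 2 ≤ c * B := by
  rcases hg.eq_or_lt with hg0 | hgpos
  · rw [← hg0, zero_pow two_ne_zero]; positivity
  have hcpos : 0 < c := by
    rcases hc.eq_or_lt with hc0 | hcpos
    · exfalso
      have h1 := h ((B + 1) / (2 * g)) (by positivity)
      rw [← hc0, mul_zero, zero_add] at h1
      have : 2 * ((B + 1) / (2 * g)) * g = B + 1 := by field_simp
      linarith
    · exact hcpos
  have h1 := h (g / c) (by positivity)
  have h2 : 2 * (g / c) * g - (g / c) ^ 2 * c = g ^ 2 / c := by field_simp; ring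
  have h3 : g ^ 2 / c ≤ B := by linarith
  rwa [div_le_iff₀ hcpos, mul_comm] at h3

end RealAnalysis

section FalkBruch

variable {Λ : Type} [LinearOrder Λ] [Fintype Λ] (G : SimpleGraph Λ) [DecidableRel G.Adj]

/-- `n_{xσ}` is Hermitian. [folklore] -/
theorem numberOp_conjTranspose (x : Λ) (σ : Fin 2) : (numberOp x σ)ᴴ = numberOp x σ :=
  (numberAt_isHermitian (orb x σ)).eq

/-- The charge field `M_k = Σ_x k_x (n_{x↑} + n_{x↓} - 1)` is Hermitian for real `k`. [folklore] -/
theorem chargeField_isHermitian (k : Λ → ℝ) :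
    (∑ x : Λ, ((k x : ℝ) : ℂ) • (numberOp x 0 + numberOp x 1 - 1) :
      Matrix (Finset (Orb Λ)) (Finset (Orb Λ)) ℂ).IsHermitian := by
  change (∑ x : Λ, ((k x : ℝ) : ℂ) • (numberOp x 0 + numberOp x 1 - 1))ᴴ = _
  simp only [conjTranspose_sum, conjTranspose_smul, conjTranspose_sub, conjTranspose_add, conjTranspose_one,
    Complex.star_def, Complex.conj_ofReal, numberOp_conjTranspose]

/-- The charge field scales linearly with the field. [folklore] -/
theorem chargeField_smul (τ : ℝ) (k : Λ → ℝ) :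
    (∑ x : Λ, ((τ * k x : ℝ) : ℂ) • (numberOp x 0 + numberOp x 1 - 1) :
      Matrix (Finset (Orb Λ)) (Finset (Orb Λ)) ℂ) =
      ((τ : ℝ) : ℂ) • ∑ x : Λ, ((k x : ℝ) : ℂ) • (numberOp x 0 + numberOp x 1 - 1) := by
  rw [Finset.smul_sum]
  refine Finset.sum_congr rfl fun x _ => ?_
  rw [smul_smul, Complex.ofReal_mul]

/-- The charge field preserves the sectors `(N↑, N↓) = (a, b)` (it is diagonal in the occupation
basis). [folklore] -/
theorem isInSector_chargeField_mulVec {a b : ℕ} {ψ : Fock (Orb Λ)} (hψ : IsInSector a b ψ) (k : Λ → ℝ) :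
    IsInSector a b ((∑ x : Λ, ((k x : ℝ) : ℂ) • (numberOp x 0 + numberOp x 1 - 1)) *ᵥ ψ) := by
  intro s hs
  rw [Matrix.sum_mulVec, Finset.sum_apply]
  refine Finset.sum_eq_zero fun x _ => ?_
  rw [smul_mulVec, Pi.smul_apply, sub_mulVec, add_mulVec, one_mulVec, Pi.sub_apply, Pi.add_apply,
    numberOp_mulVec, numberOp_mulVec, hψ s hs]
  simp

/-- The shifted form of the charge field acting on a vector:
`M_k ψ = (Σ_x k_x n_x) ψ - (Σ_x k_x) ψ`. [folklore] -/
theorem chargeField_mulVec_eq_shifted (k : Λ → ℝ) (ψ : Fock (Orb Λ)) :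
    (∑ x : Λ, ((k x : ℝ) : ℂ) • (numberOp x 0 + numberOp x 1 - 1)) *ᵥ ψ =
      (∑ x : Λ, ((k x : ℝ) : ℂ) • (numberOp x 0 + numberOp x 1)) *ᵥ ψ - ((∑ x : Λ, k x : ℝ) : ℂ) • ψ := by
  simp only [smul_sub, Finset.sum_sub_distrib, sub_mulVec, Matrix.sum_mulVec, smul_mulVec, one_mulVec,
    Complex.ofReal_sum, Finset.sum_smul]

/-- **The Falk–Bruch step at zero temperature: charge fluctuations of a half-filled ground state.**
On a bipartite graph, for `U > 0`, a half-filled sector `(a, b)` (`a + b = |Λ|`) with lower bound `E`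
of `H = hamiltonian G t U`, a ground state `ψ₀` of that sector AT `E` (`Hψ₀ = Eψ₀`) and a real field
`k`, the fluctuation vector `φ = Σ_x k_x (n_x - 1) ψ₀` obeys
`‖φ‖⁴ ≤ ⟨φ, (H - E) φ⟩ · (Σ_x k_x²/(2U)) · ‖ψ₀‖²`
(Gaussian domination applied to `ψ₀ ± sφ` with the fields `±τk`, second order in `s = στ`, `τ → 0`,
then the optimal `σ`: the `T = 0` form of the Falk–Bruch / Dyson–Lieb–Simon bound
`½⟨{A,A}⟩ ≤ √(susceptibility · double commutator)`). Dyson–Lieb–Simon, J. Stat. Phys. 18 (1978) 335,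
Thm 3.2 / Cor. 3.2 (`β → ∞`); Kubo–Kishi, PRB 41 (1990) 4866, Remark after Thm 2. [folklore] -/
theorem chargeFluctuation_falkBruch (A : Finset Λ) (hA : ∀ x y : Λ, G.Adj x y → (x ∈ A ↔ y ∉ A))
    (t : ℝ) {U : ℝ} (hU : 0 < U) {a b : ℕ} (hab : a + b = Fintype.card Λ) {E : ℝ}
    (hE : ∀ φ : Fock (Orb Λ), IsInSector a b φ →
      E * (star φ ⬝ᵥ φ).re ≤ (star φ ⬝ᵥ (hamiltonian G t U *ᵥ φ)).re)
    {ψ₀ : Fock (Orb Λ)} (hψ₀ : IsInSector a b ψ₀) (hHψ₀ : hamiltonian G t U *ᵥ ψ₀ = (E : ℂ) • ψ₀)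
    (k : Λ → ℝ) (φ : Fock (Orb Λ))
    (hφ : φ = (∑ x : Λ, ((k x : ℝ) : ℂ) • (numberOp x 0 + numberOp x 1)) *ᵥ ψ₀ - ((∑ x : Λ, k x : ℝ) : ℂ) • ψ₀) :
    ((star φ ⬝ᵥ φ).re) ^ 2 ≤
      ((star φ ⬝ᵥ (hamiltonian G t U *ᵥ φ)).re - E * (star φ ⬝ᵥ φ).re) *
        ((∑ x : Λ, k x ^ 2) / (2 * U) * (star ψ₀ ⬝ᵥ ψ₀).re) := by
  set H := hamiltonian G t U with hHdef
  set Mk : Matrix (Finset (Orb Λ)) (Finset (Orb Λ)) ℂ :=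
    ∑ x : Λ, ((k x : ℝ) : ℂ) • (numberOp x 0 + numberOp x 1 - 1) with hMkdef
  have hφM : φ = Mk *ᵥ ψ₀ := by rw [hφ, hMkdef, chargeField_mulVec_eq_shifted]
  have hMk : Mk.IsHermitian := chargeField_isHermitian k
  have hφsec : IsInSector a b φ := by rw [hφM]; exact isInSector_chargeField_mulVec hψ₀ k
  -- the shifted Hamiltonian `K = H - E`
  set K : Matrix (Finset (Orb Λ)) (Finset (Orb Λ)) ℂ := H - (E : ℂ) • (1 : Matrix _ _ ℂ) with hKdef
  have hHherm : Hᴴ = H := (LiebThm1.hamiltonian_isHermitian G t U).eq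
  have hK : K.IsHermitian := by
    change Kᴴ = K
    rw [hKdef, conjTranspose_sub, conjTranspose_smul, conjTranspose_one, hHherm, Complex.star_def,
      Complex.conj_ofReal]
  have hKv : ∀ χ : Fock (Orb Λ), K *ᵥ χ = H *ᵥ χ - (E : ℂ) • χ := by
    intro χ; rw [hKdef, sub_mulVec, smul_mulVec, one_mulVec]
  have hform : ∀ χ : Fock (Orb Λ),
      (star χ ⬝ᵥ (K *ᵥ χ)).re = (star χ ⬝ᵥ (H *ᵥ χ)).re - E * (star χ ⬝ᵥ χ).re := by
    intro χ
    rw [hKv, dotProduct_sub, dotProduct_smul, smul_eq_mul, Complex.sub_re, Complex.re_ofReal_mul]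
  have hKψ₀ : K *ᵥ ψ₀ = 0 := by rw [hKv, hHψ₀, sub_self]
  have h1herm : (1 : Matrix (Finset (Orb Λ)) (Finset (Orb Λ)) ℂ).IsHermitian := isHermitian_one
  -- cross terms
  have hcross1 : (star ψ₀ ⬝ᵥ (Mk *ᵥ φ)).re = (star φ ⬝ᵥ φ).re := by
    rw [hφM, EnslavedA1g.star_dotProduct_mulVec_eq_conjTranspose, hMk.eq]
  have hcross2 : (star ψ₀ ⬝ᵥ (K *ᵥ φ)).re = 0 := by
    rw [← tian_re_form_symm hK, hKψ₀, dotProduct_zero, Complex.zero_re]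
  have hcross3 : (star ψ₀ ⬝ᵥ φ).re = (star ψ₀ ⬝ᵥ (Mk *ᵥ ψ₀)).re := by rw [hφM]
  have hKψψ : (star ψ₀ ⬝ᵥ (K *ᵥ ψ₀)).re = 0 := by rw [hKψ₀, dotProduct_zero, Complex.zero_re]
  -- Gaussian domination on the lines `ψ₀ - rφ`, field `θ k`
  have hGD : ∀ r θ : ℝ,
      θ * ((star φ ⬝ᵥ (Mk *ᵥ φ)).re * (r * r) + -(2 * (star φ ⬝ᵥ φ).re) * r +
          (star ψ₀ ⬝ᵥ (Mk *ᵥ ψ₀)).re) ≤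
        (star φ ⬝ᵥ (K *ᵥ φ)).re * (r * r) +
          θ ^ 2 * (∑ x : Λ, k x ^ 2) / (2 * U) *
            ((star φ ⬝ᵥ φ).re * (r * r) + -(2 * (star ψ₀ ⬝ᵥ (Mk *ᵥ ψ₀)).re) * r + (star ψ₀ ⬝ᵥ ψ₀).re) := by
    intro r θ
    have hsec : IsInSector a b (ψ₀ - (r : ℂ) • φ) := hψ₀.sub (hφsec.smul _)
    have key := gaussianDomination_halfFilled G A hA t hU hab hE hsec (fun x => θ * k x)
    rw [← hHdef, chargeField_smul, ← hMkdef, smul_mulVec, dotProduct_smul, smul_eq_mul,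
      Complex.re_ofReal_mul, tian_re_form_sub_smul hMk, hcross1] at key
    have hKexp := tian_re_form_sub_smul hK ψ₀ φ r
    rw [hcross2, hKψψ, hform] at hKexp
    have hnorm := tian_re_form_sub_smul h1herm ψ₀ φ r
    simp only [one_mulVec] at hnorm
    rw [hcross3] at hnorm
    have hsq : ∑ x : Λ, (θ * k x) ^ 2 = θ ^ 2 * ∑ x : Λ, k x ^ 2 := by
      rw [Finset.mul_sum]
      exact Finset.sum_congr rfl fun x _ => by ring
    rw [hKexp, hsq, hnorm] at key
    have e : (star φ ⬝ᵥ (K *ᵥ φ)).re * (r * r) + -(2 * 0) * r + 0 = (star φ ⬝ᵥ (K *ᵥ φ)).re * (r * r) := by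
      ring
    rw [e] at key
    exact key
  -- the real quantities
  set g : ℝ := (star φ ⬝ᵥ φ).re with hgdef
  set n₀ : ℝ := (star ψ₀ ⬝ᵥ ψ₀).re with hn₀def
  set c : ℝ := (star φ ⬝ᵥ (K *ᵥ φ)).re with hcdef
  set m₀ : ℝ := (star ψ₀ ⬝ᵥ (Mk *ᵥ ψ₀)).re with hm₀def
  set mφ : ℝ := (star φ ⬝ᵥ (Mk *ᵥ φ)).re with hmφdef
  set Kk : ℝ := ∑ x : Λ, k x ^ 2 with hKkdef
  have hg : 0 ≤ g := (Complex.nonneg_iff.mp (dotProduct_star_self_nonneg _)).1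
  have hn₀ : 0 ≤ n₀ := (Complex.nonneg_iff.mp (dotProduct_star_self_nonneg _)).1
  have hKk : 0 ≤ Kk := Finset.sum_nonneg fun x _ => sq_nonneg (k x)
  have hc : 0 ≤ c := by
    rw [hcdef, hform]
    have := hE φ hφsec
    linarith
  -- symmetrise: `4 τ s g ≤ 2 c s² + (τ² Kk / 2U)(2 g s² + 2 n₀)`
  have hsym : ∀ s τ : ℝ,
      4 * τ * s * g ≤ 2 * c * s ^ 2 + τ ^ 2 * Kk / (2 * U) * (2 * g * s ^ 2 + 2 * n₀) := by
    intro s τ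
    have h1 := hGD (-s) τ
    have h2 := hGD s (-τ)
    have h3 := add_le_add h1 h2
    have e1 : τ * (mφ * (-s * -s) + -(2 * g) * -s + m₀) + -τ * (mφ * (s * s) + -(2 * g) * s + m₀) =
        4 * τ * s * g := by ring
    have e2 : c * (-s * -s) + τ ^ 2 * Kk / (2 * U) * (g * (-s * -s) + -(2 * m₀) * -s + n₀) +
        (c * (s * s) + (-τ) ^ 2 * Kk / (2 * U) * (g * (s * s) + -(2 * m₀) * s + n₀)) =
        2 * c * s ^ 2 + τ ^ 2 * Kk / (2 * U) * (2 * g * s ^ 2 + 2 * n₀) := by ring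
    rw [e1, e2] at h3
    exact h3
  -- scale `s = τ σ` and let `τ → 0`
  have hσ : ∀ σ : ℝ, 0 < σ → 2 * σ * g ≤ σ ^ 2 * c + Kk / (2 * U) * n₀ := by
    intro σ hσ
    refine le_of_forall_pos_le_add_mul_sq (d := Kk / (2 * U) * g * σ ^ 2) (by positivity) fun τ hτ => ?_
    have h := hsym (τ * σ) τ
    have e1 : 4 * τ * (τ * σ) * g = 2 * τ ^ 2 * (2 * σ * g) := by ring
    have e2 : 2 * c * (τ * σ) ^ 2 + τ ^ 2 * Kk / (2 * U) * (2 * g * (τ * σ) ^ 2 + 2 * n₀) =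
        2 * τ ^ 2 * (σ ^ 2 * c + Kk / (2 * U) * n₀ + Kk / (2 * U) * g * σ ^ 2 * τ ^ 2) := by ring
    rw [e1, e2] at h
    exact le_of_mul_le_mul_left h (by positivity)
  -- optimise `σ`
  have hfin := sq_le_mul_of_forall_pos hg hc (by positivity) hσ
  rw [hcdef, hform] at hfin
  calc ((star φ ⬝ᵥ φ).re) ^ 2 = g ^ 2 := by rw [hgdef]
    _ ≤ ((star φ ⬝ᵥ (H *ᵥ φ)).re - E * (star φ ⬝ᵥ φ).re) * (Kk / (2 * U) * n₀) := hfin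
    _ = _ := by rw [hKkdef, hn₀def]

end FalkBruch

/-! ### The Hubbard torus -/

section Torus

/-- **Registered stub `stub_halfFillingChargeFluctuation`** of crux `NoOnsiteODLRO`
(stmt-HubbardSuperconductivity-0933; by-product — input of the `δ = 0` endpoint, not a piece of a line
composition): the zero-temperature Falk–Bruch bound for the half-filled Hubbard torus — for `U > 0`, `L`
even, `2n = L²`, every vector `ψ` of the sector `(n, n)` solving the eigenvalue equation at the sector ground
energy and every real field `k`, the fluctuation `φ = Σ_x k_x n_x ψ - (Σ_x k_x) ψ` obeys
`‖φ‖⁴ ≤ ⟨φ, (H - E(L²,0)) φ⟩ · (Σ_x k_x²/(2U)) · ‖ψ‖²` (`chargeFluctuation_falkBruch`).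
Dyson–Lieb–Simon, J. Stat. Phys. 18 (1978) 335, Thm 3.2; Kubo–Kishi, PRB 41 (1990) 4866. [cite: DLS1978, Theorem 3.2] -/
theorem stub_halfFillingChargeFluctuation : open Literature.MathematicalPhysics.QuantumLattice in ∀ (U : ℝ), 0 < U → ∀ (L : ℕ) [NeZero L], Even L → ∀ (n : ℕ), 2 * n = L ^ 2 → ∀ ψ : Fock (Orb (FermionTorus 2 L)), IsInSector n n ψ → hubbardTorus 2 L 1 U *ᵥ ψ = (((hubbardTorus 2 L 1 U).minEnergyOn (szSector (2 * n) 0) : ℝ) : ℂ) • ψ → ∀ (k : FermionTorus 2 L → ℝ) (φ : Fock (Orb (FermionTorus 2 L))), φ = (∑ x : FermionTorus 2 L, ((k x : ℝ) : ℂ) • (numberOp x 0 + numberOp x 1)) *ᵥ ψ - ((∑ x : FermionTorus 2 L, k x : ℝ) : ℂ) • ψ → ((star φ ⬝ᵥ φ).re) ^ 2 ≤ ((star φ ⬝ᵥ (hubbardTorus 2 L 1 U *ᵥ φ)).re - (hubbardTorus 2 L 1 U).minEnergyOn (szSector (2 * n) 0) * (star φ ⬝ᵥ φ).re) * ((∑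 x : FermionTorus 2 L, k x ^ 2) / (2 * U) * (star ψ ⬝ᵥ ψ).re) := by
  intro U hU L _ hL n hn ψ hψ hHψ k φ hφ
  have hcard : Fintype.card (FermionTorus 2 L) = L ^ 2 := card_fermionTorus 2 L
  have hnn : n + n = Fintype.card (FermionTorus 2 L) := by omega
  have hnle : n ≤ Fintype.card (FermionTorus 2 L) := by omega
  have hvar : ∀ χ : Fock (Orb (FermionTorus 2 L)), IsInSector n n χ →
      (hamiltonian (fermionTorusGraph 2 L) 1 U).minEnergyOn (szSector (2 * n) 0) * (star χ ⬝ᵥ χ).re ≤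
        (star χ ⬝ᵥ (hamiltonian (fermionTorusGraph 2 L) 1 U *ᵥ χ)).re :=
    fun χ hχ => (szSector_groundState (fermionTorusGraph 2 L) 1 U hnle).2 χ hχ
  exact chargeFluctuation_falkBruch (fermionTorusGraph 2 L)
    (Finset.univ.filter fun z : FermionTorus 2 L => torusStagger z = 1) (torus_colouring hL) 1 hU hnn hvar hψ
    hHψ k φ hφ

end Torus

end Summit.HubbardSuperconductivity.HubbardSuperconductivity.Theorems.NoOnsiteODLRO.HalfFilling
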